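import Literature.NumberTheory.GelbartRogawski1991.DoubledUnitaryGlobalSplittingData
import Literature.NumberTheory.Weil1964.ArchActQuadraticPlaces
import HarnessLib

/-!
# The archimedean Siegel parabolic of the doubled unitary group acts on the diagonal through `Res(α)`:
# `ι^𝔻(p)` on diagonal archimedean pairs, place by place, and `det_ℝ = |det_Δ p|_{𝔸_L}`
([Kudla1994, §3]: `P_Δ = M N`, `m(a)` acts on `Δ ≅ Eⁿ` by `a`, `|x(m(a))| = |det a|`; [HarrisKudlaSweet1996,
§1 (1.11)–(1.15)]; archimedean places of the kernel construction of [GelbartRogawski1991, Prop. 3.1.1])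

Topic `NumberTheory/GelbartRogawski1991`; namespace `Literature.NumberTheory.GelbartRogawski1991.GRConstruction`
(continues `DoubledUnitaryGlobalSplittingData`).  KERNEL only: definitions with bodies and proved theorems; no new
notion, no named fact, no `sorry`.

Setting: the doubled hermitian space `𝔻 = 𝕍 ⊕ (−𝕍)` of `DoubledUnitaryGlobalSplittingData` (`H(𝔸) = U(J^𝔻)(𝔸_{L⁺})`,
Siegel predicate `IsSiegelDelta`, `deltaBlock p = p₁₁ + p₁₂`, `detDelta`, `modDelta`, `ι^𝔻 = toSpD`), the
archimedean coordinates `archVec ∕ piArch ∕ archAct ∕ placeVec` of the `Weil1964` files, and the quadratic coordinates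
`Res_{ℂ/ℝ}` = `IsQuadraticCoordinates.resEnd` of `UnitaryGroupSymplecticEmbedding` at a complex place `w ∣ v`
(`ArchActQuadraticPlaces.placeVec_piArch_resEnd`).  A *diagonal pair* is `((a, a), (z, z))` — the `X`/`Y` coordinates of a
vector of the diagonal `Δ ⊗ ℝ ⊂ 𝔻 ⊗ ℝ`, re-enumerated by `e₂`.

* §1 block algebra: a matrix `G` with `G₁₁ + G₁₂ = G₂₁ + G₂₂` maps `(W, W)` to `(α W, α W)`, `α = G₁₁ + G₁₂`; `reIm` of
  diagonal vectors; hence `Res G` maps diagonal pairs to diagonal pairs through `Res α` (`resEnd_diagPair`);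
* §2 the Siegel condition and `deltaBlock` under a ring homomorphism (read at a complex place: `adeleMatAt`);
* §3 **`placeVec_archAct_toSpD_diagPair`** — for `p ∈ P_Δ(𝔸)` the `v`-slices of `archAct (ι^𝔻 p)` on a diagonal pair
  are the diagonal pair of `Res_{ℂ/ℝ}(α_{w})`, `α_w = (deltaBlock p)_w`, `w ∣ v`;
* §4 the global real-linear map `archDiagAct p = ⊕_v Res_{ℂ/ℝ}(α_{w(v)})` on pairs `(a, z)`:
  **`archAct_toSpD_diagPair`** (`ι^𝔻(p)` acts on diagonal pairs through it) and
  **`det_archDiagAct`** (`det_ℝ = ∏_v |det α_{w(v)}|²`, Mathlib `LinearMap.det_restrictScalars`, `LinearMap.det_pi`);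
* the sibling `DoubledUnitaryArchSiegelDiagonalModulus` specialises to the archimedean element `p = (g, 1)`:
  `∏_v |det α_{w(v)}|² = |det_Δ p|_{𝔸_L} = modDelta p ^ 2`, whence a real-linear automorphism `A` of the pairs with
  `archAct (ι^𝔻 (g,1)) (diag a, diag z) = diag (A (a, z))`, `0 < det A`, `det A = modDelta (g,1) ^ 2`.

Written for the stage-1 cell `pub-hodgecm` (third hand `own-crow` for seat GR-3 = `own-s1arch`: this is the input
`stub_S1arch_archActDiag` ∕ `S1arch_modulus` of the archimedean half of the [GR91 3.1.1] kernel construction, in tree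
vocabulary); nothing here is a claim of the manuscripts adjudicated by that cell.

## References

* S. S. Kudla, *Splitting metaplectic covers of dual reductive pairs*, Israel J. Math. 87 (1994) 361–401, §3 [Kudla1994].
* M. Harris, S. S. Kudla, W. J. Sweet, *Theta dichotomy for unitary groups*, J. Amer. Math. Soc. 9 (1996), §1 [HarrisKudlaSweet1996].
* S. Gelbart, J. Rogawski, Invent. Math. 105 (1991), §3.1 Prop. 3.1.1 p. 455 [GelbartRogawski1991].
* A. Borel, H. Jacquet, PSPM 33.1 (1979), §4.1 [BorelJacquet1979].
-/

set_option autoImplicit false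

noncomputable section

open scoped Classical
open scoped Matrix
open NumberField NumberField.InfinitePlace NumberField.mixedEmbedding IsDedekindDomain
open Literature.NumberTheory.Automorphic Literature.NumberTheory.Automorphic.UnitaryGroup
open Literature.NumberTheory.Weil1964
open Literature.RepresentationTheory.HeisenbergGroup

namespace Literature.NumberTheory.GelbartRogawski1991.GRConstruction

open UnitaryDualPair QuadraticCoordinates

/-! ## §1 Block algebra: matrices preserving the diagonal, `reIm` of diagonal vectors -/

section Blocks

variable {R S : Type*} [CommRing R] [CommRing S] {n : ℕ}

/-- `G · (f ∘ e₂⁻¹) = ((reindex e₂⁻¹ e₂⁻¹ G) · f) ∘ e₂⁻¹`: matrix action in the block enumeration. [folklore] -/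
private theorem mulVec_comp_e₂_symm (G : Matrix (Fin (n + n)) (Fin (n + n)) S) (f : Fin n ⊕ Fin n → S) :
    G *ᵥ (f ∘ ⇑(e₂ (n := n)).symm) =
      (Matrix.reindex (e₂ (n := n)).symm (e₂ (n := n)).symm G *ᵥ f) ∘ ⇑(e₂ (n := n)).symm := by
  rw [Matrix.reindex_apply, Equiv.symm_symm, Matrix.submatrix_mulVec_equiv]
  funext j
  simp only [Function.comp_apply, Equiv.apply_symm_apply]

/-- **a matrix with `G₁₁ + G₁₂ = G₂₁ + G₂₂` maps a diagonal vector `(W, W)` to `(α W, α W)`, `α = G₁₁ + G₁₂`.**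
[cite: Kudla1994, §3] -/
theorem mulVec_diag_of_blocks (G : Matrix (Fin (n + n)) (Fin (n + n)) S)
    (hG : (Matrix.reindex (e₂ (n := n)).symm (e₂ (n := n)).symm G).toBlocks₁₁ +
        (Matrix.reindex (e₂ (n := n)).symm (e₂ (n := n)).symm G).toBlocks₁₂ =
      (Matrix.reindex (e₂ (n := n)).symm (e₂ (n := n)).symm G).toBlocks₂₁ +
        (Matrix.reindex (e₂ (n := n)).symm (e₂ (n := n)).symm G).toBlocks₂₂)
    (W : Fin n → S) :
    G *ᵥ (Sum.elim W W ∘ ⇑(e₂ (n := n)).symm) =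
      Sum.elim (((Matrix.reindex (e₂ (n := n)).symm (e₂ (n := n)).symm G).toBlocks₁₁ +
          (Matrix.reindex (e₂ (n := n)).symm (e₂ (n := n)).symm G).toBlocks₁₂) *ᵥ W)
        (((Matrix.reindex (e₂ (n := n)).symm (e₂ (n := n)).symm G).toBlocks₁₁ +
          (Matrix.reindex (e₂ (n := n)).symm (e₂ (n := n)).symm G).toBlocks₁₂) *ᵥ W) ∘ ⇑(e₂ (n := n)).symm := by
  rw [mulVec_comp_e₂_symm]
  set B := Matrix.reindex (e₂ (n := n)).symm (e₂ (n := n)).symm G with hB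
  have h1 : B *ᵥ Sum.elim W W =
      Sum.elim ((B.toBlocks₁₁ + B.toBlocks₁₂) *ᵥ W) ((B.toBlocks₂₁ + B.toBlocks₂₂) *ᵥ W) := by
    conv_lhs => rw [← Matrix.fromBlocks_toBlocks B]
    rw [Matrix.fromBlocks_mulVec, Sum.elim_comp_inl, Sum.elim_comp_inr, Matrix.add_mulVec, Matrix.add_mulVec]
  rw [h1, ← hG]

variable (Ψ : (R × R) ≃+ S)

/-- `reIm` of a diagonal vector is a pair of diagonal vectors. [folklore] -/
private theorem reIm_sumElim_diag (W : Fin n → S) :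
    reIm Ψ (Fin (n + n)) (Sum.elim W W ∘ ⇑(e₂ (n := n)).symm) =
      (Sum.elim (reIm Ψ (Fin n) W).1 (reIm Ψ (Fin n) W).1 ∘ ⇑(e₂ (n := n)).symm,
        Sum.elim (reIm Ψ (Fin n) W).2 (reIm Ψ (Fin n) W).2 ∘ ⇑(e₂ (n := n)).symm) := by
  refine Prod.ext (funext fun j => ?_) (funext fun j => ?_)
  · rw [reIm_apply_fst]
    simp only [Function.comp_apply]
    rcases (e₂ (n := n)).symm j with k | k <;> rfl
  · rw [reIm_apply_snd]
    simp only [Function.comp_apply]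
    rcases (e₂ (n := n)).symm j with k | k <;> rfl

/-- `reIm⁻¹` of a pair of diagonal vectors is the diagonal vector of `reIm⁻¹`. [folklore] -/
private theorem reIm_symm_sumElim_diag (x y : Fin n → R) :
    (reIm Ψ (Fin (n + n))).symm (Sum.elim x x ∘ ⇑(e₂ (n := n)).symm, Sum.elim y y ∘ ⇑(e₂ (n := n)).symm) =
      Sum.elim ((reIm Ψ (Fin n)).symm (x, y)) ((reIm Ψ (Fin n)).symm (x, y)) ∘ ⇑(e₂ (n := n)).symm := by
  funext j
  rw [reIm_symm_apply]
  simp only [Function.comp_apply]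
  rcases (e₂ (n := n)).symm j with k | k <;> rfl

/-- **`Res G` maps diagonal pairs to diagonal pairs through `Res α`** (`G₁₁ + G₁₂ = G₂₁ + G₂₂`, `α = G₁₁ + G₁₂`), for any
quadratic coordinates. [cite: Kudla1994, §3] -/
theorem resEnd_diagPair {φ : R →+* S} {δ : S} {d : R} (h : IsQuadraticCoordinates φ Ψ δ d)
    (G : Matrix (Fin (n + n)) (Fin (n + n)) S)
    (hG : (Matrix.reindex (e₂ (n := n)).symm (e₂ (n := n)).symm G).toBlocks₁₁ +
        (Matrix.reindex (e₂ (n := n)).symm (e₂ (n := n)).symm G).toBlocks₁₂ =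
      (Matrix.reindex (e₂ (n := n)).symm (e₂ (n := n)).symm G).toBlocks₂₁ +
        (Matrix.reindex (e₂ (n := n)).symm (e₂ (n := n)).symm G).toBlocks₂₂)
    (x y : Fin n → R) :
    h.resEnd (Fin (n + n)) G (Sum.elim x x ∘ ⇑(e₂ (n := n)).symm, Sum.elim y y ∘ ⇑(e₂ (n := n)).symm) =
      (Sum.elim (h.resEnd (Fin n) ((Matrix.reindex (e₂ (n := n)).symm (e₂ (n := n)).symm G).toBlocks₁₁ +
            (Matrix.reindex (e₂ (n := n)).symm (e₂ (n := n)).symm G).toBlocks₁₂) (x, y)).1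
          (h.resEnd (Fin n) ((Matrix.reindex (e₂ (n := n)).symm (e₂ (n := n)).symm G).toBlocks₁₁ +
            (Matrix.reindex (e₂ (n := n)).symm (e₂ (n := n)).symm G).toBlocks₁₂) (x, y)).1 ∘ ⇑(e₂ (n := n)).symm,
        Sum.elim (h.resEnd (Fin n) ((Matrix.reindex (e₂ (n := n)).symm (e₂ (n := n)).symm G).toBlocks₁₁ +
            (Matrix.reindex (e₂ (n := n)).symm (e₂ (n := n)).symm G).toBlocks₁₂) (x, y)).2
          (h.resEnd (Fin n) ((Matrix.reindex (e₂ (n := n)).symm (e₂ (n := n)).symm G).toBlocks₁₁ +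
            (Matrix.reindex (e₂ (n := n)).symm (e₂ (n := n)).symm G).toBlocks₁₂) (x, y)).2 ∘ ⇑(e₂ (n := n)).symm) := by
  set α := (Matrix.reindex (e₂ (n := n)).symm (e₂ (n := n)).symm G).toBlocks₁₁ +
    (Matrix.reindex (e₂ (n := n)).symm (e₂ (n := n)).symm G).toBlocks₁₂ with hα
  have hxy : (x, y) = reIm Ψ (Fin n) ((reIm Ψ (Fin n)).symm (x, y)) := ((reIm Ψ (Fin n)).apply_symm_apply _).symm
  have hd : (Sum.elim x x ∘ ⇑(e₂ (n := n)).symm, Sum.elim y y ∘ ⇑(e₂ (n := n)).symm) =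
      reIm Ψ (Fin (n + n)) (Sum.elim ((reIm Ψ (Fin n)).symm (x, y)) ((reIm Ψ (Fin n)).symm (x, y)) ∘
        ⇑(e₂ (n := n)).symm) := by
    rw [← reIm_symm_sumElim_diag Ψ x y, AddEquiv.apply_symm_apply]
  rw [hd, h.resEnd_reIm, mulVec_diag_of_blocks G hG, reIm_sumElim_diag]
  conv_rhs => rw [hxy, h.resEnd_reIm]

end Blocks

/-! ## §2 The Siegel condition and `deltaBlock` under a ring homomorphism -/

section MapBlocks

variable {R S : Type*} [CommRing R] [CommRing S] {n : ℕ}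

/-- `(f G)₁₁ + (f G)₁₂ = f (G₁₁ + G₁₂)` in the block enumeration. [folklore] -/
private theorem blocks₁_map (f : R →+* S) (G : Matrix (Fin (n + n)) (Fin (n + n)) R) :
    (Matrix.reindex (e₂ (n := n)).symm (e₂ (n := n)).symm (G.map f)).toBlocks₁₁ +
        (Matrix.reindex (e₂ (n := n)).symm (e₂ (n := n)).symm (G.map f)).toBlocks₁₂ =
      ((Matrix.reindex (e₂ (n := n)).symm (e₂ (n := n)).symm G).toBlocks₁₁ +
        (Matrix.reindex (e₂ (n := n)).symm (e₂ (n := n)).symm G).toBlocks₁₂).map f := by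
  ext i j
  exact (map_add f _ _).symm

/-- `(f G)₂₁ + (f G)₂₂ = f (G₂₁ + G₂₂)` in the block enumeration. [folklore] -/
private theorem blocks₂_map (f : R →+* S) (G : Matrix (Fin (n + n)) (Fin (n + n)) R) :
    (Matrix.reindex (e₂ (n := n)).symm (e₂ (n := n)).symm (G.map f)).toBlocks₂₁ +
        (Matrix.reindex (e₂ (n := n)).symm (e₂ (n := n)).symm (G.map f)).toBlocks₂₂ =
      ((Matrix.reindex (e₂ (n := n)).symm (e₂ (n := n)).symm G).toBlocks₂₁ +
        (Matrix.reindex (e₂ (n := n)).symm (e₂ (n := n)).symm G).toBlocks₂₂).map f := by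
  ext i j
  exact (map_add f _ _).symm

variable (L : Type) [Field L] [NumberField L] [IsCMField L]
variable {N M : ℕ} (e : Fin N × Fin M ≃ Fin n)
  (dV : Fin N → L) (hdV : ∀ i, IsCMField.complexConj L (dV i) = dV i)
  (dW : Fin M → L) (hdW : ∀ i, IsCMField.complexConj L (dW i) = dW i)

/-- **the Siegel condition survives any ring homomorphism `f : 𝔸_L → S`** (e.g. reading at a place): the mapped matrix
`f(p)` satisfies `f(p)₁₁ + f(p)₁₂ = f(p)₂₁ + f(p)₂₂`. [cite: Kudla1994, §3] -/
theorem blocks_map_of_isSiegelDelta (f : AdeleRing (𝓞 L) L →+* S) (p : HA L e dV hdV dW hdW)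
    (hS : IsSiegelDelta L e dV hdV dW hdW p) :
    (Matrix.reindex (e₂ (n := n)).symm (e₂ (n := n)).symm
          (((p : GL (Fin (n + n)) (AdeleRing (𝓞 L) L)) : Matrix (Fin (n + n)) (Fin (n + n)) (AdeleRing (𝓞 L) L)).map f)).toBlocks₁₁ +
        (Matrix.reindex (e₂ (n := n)).symm (e₂ (n := n)).symm
          (((p : GL (Fin (n + n)) (AdeleRing (𝓞 L) L)) : Matrix (Fin (n + n)) (Fin (n + n)) (AdeleRing (𝓞 L) L)).map f)).toBlocks₁₂ =
      (Matrix.reindex (e₂ (n := n)).symm (e₂ (n := n)).symm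
          (((p : GL (Fin (n + n)) (AdeleRing (𝓞 L) L)) : Matrix (Fin (n + n)) (Fin (n + n)) (AdeleRing (𝓞 L) L)).map f)).toBlocks₂₁ +
        (Matrix.reindex (e₂ (n := n)).symm (e₂ (n := n)).symm
          (((p : GL (Fin (n + n)) (AdeleRing (𝓞 L) L)) : Matrix (Fin (n + n)) (Fin (n + n)) (AdeleRing (𝓞 L) L)).map f)).toBlocks₂₂ := by
  rw [blocks₁_map, blocks₂_map]
  exact congrArg (fun B : Matrix (Fin n) (Fin n) (AdeleRing (𝓞 L) L) => B.map f) hS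

/-- `f(p)₁₁ + f(p)₁₂ = f (deltaBlock p)`. [cite: Kudla1994, §3] -/
theorem blocks₁_map_eq_deltaBlock_map (f : AdeleRing (𝓞 L) L →+* S) (p : HA L e dV hdV dW hdW) :
    (Matrix.reindex (e₂ (n := n)).symm (e₂ (n := n)).symm
          (((p : GL (Fin (n + n)) (AdeleRing (𝓞 L) L)) : Matrix (Fin (n + n)) (Fin (n + n)) (AdeleRing (𝓞 L) L)).map f)).toBlocks₁₁ +
        (Matrix.reindex (e₂ (n := n)).symm (e₂ (n := n)).symm
          (((p : GL (Fin (n + n)) (AdeleRing (𝓞 L) L)) : Matrix (Fin (n + n)) (Fin (n + n)) (AdeleRing (𝓞 L) L)).map f)).toBlocks₁₂ =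
      (deltaBlock L e dV hdV dW hdW p).map f := by
  rw [blocks₁_map]
  rfl

end MapBlocks

/-! ## §3 The `v`-slices of `archAct (ι^𝔻 p)` on a diagonal pair, `p ∈ P_Δ(𝔸)` -/

section Slices

variable (L : Type) [Field L] [NumberField L] [IsCMField L]
variable {N M n : ℕ} (e : Fin N × Fin M ≃ Fin n)
  (dV : Fin N → L) (hdV : ∀ i, IsCMField.complexConj L (dV i) = dV i)
  (dW : Fin M → L) (hdW : ∀ i, IsCMField.complexConj L (dW i) = dW i)

/-- `σ_w(δ)` is purely imaginary at a complex place `w` of the CM field (`δ = imagUnit L`; complex conjugation fixes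
every place of `L`). [cite: GelbartRogawski1991, §3.1 p. 454] -/
theorem re_embedding_imagUnit (w : {w : InfinitePlace L // w.IsComplex}) : (w.1.embedding (imagUnit L)).re = 0 :=
  re_embedding_delta (Fp L) L (IsCMField.complexConj L) w (complexConj_smul_infinitePlace L w.1)
    (IsCMField.complexConj_ne_one L) (complexConj_imagUnit L)

/-- `σ_w(δ) ≠ 0`. [cite: GelbartRogawski1991, §3.1 p. 454] -/
theorem im_embedding_imagUnit_ne_zero (w : {w : InfinitePlace L // w.IsComplex}) :
    (w.1.embedding (imagUnit L)).im ≠ 0 :=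
  im_embedding_delta_ne_zero (Fp L) L (IsCMField.complexConj L) w (complexConj_smul_infinitePlace L w.1)
    (IsCMField.complexConj_ne_one L) (complexConj_imagUnit L) (imagUnit_ne_zero L)

/-- the complex coordinates `ℂ = ℝ ⊕ ℝ σ_w(δ)` at the complex place `w` (`E_w = ℂ`, `W_v = Res_{ℂ/ℝ} V_w`).
[cite: GelbartRogawski1991, §3.1 p. 454] -/
abbrev ccAt (w : {w : InfinitePlace L // w.IsComplex}) :
    IsQuadraticCoordinates Complex.ofRealHom
      (complexCoords (w.1.embedding (imagUnit L)) (re_embedding_imagUnit L w) (im_embedding_imagUnit_ne_zero L w))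
      (w.1.embedding (imagUnit L)) (-((w.1.embedding (imagUnit L)).im ^ 2)) :=
  isQuadraticCoordinates_complex _ _ _

/-- **`Res_{ℂ/ℝ}(α_w)`**: the real-linear map of `ℝⁿ × ℝⁿ ≅ ℂⁿ` given by the `w`-component
`α_w = σ_w((deltaBlock p)_w)` of the `Δ`-block of `p`. [cite: Kudla1994, §3] -/
def resDeltaBlockAt (w : {w : InfinitePlace L // w.IsComplex}) (p : HA L e dV hdV dW hdW) :
    ((Fin n → ℝ) × (Fin n → ℝ)) →ₗ[ℝ] ((Fin n → ℝ) × (Fin n → ℝ)) :=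
  (ccAt L w).resEnd (Fin n) (adeleMatAt L (Fin n) w (deltaBlock L e dV hdV dW hdW p))

omit [NumberField L] [IsCMField L] in
/-- `placeVec` of a diagonal vector is diagonal. [folklore] -/
private theorem placeVec_diag (v : {v : InfinitePlace (Fp L) // v.IsReal}) (a : Fin n → mixedSpace (Fp L)) :
    placeVec (Fp L) (Fin (n + n)) v (Sum.elim a a ∘ ⇑(e₂ (n := n)).symm) =
      Sum.elim (placeVec (Fp L) (Fin n) v a) (placeVec (Fp L) (Fin n) v a) ∘ ⇑(e₂ (n := n)).symm := by
  funext j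
  rw [placeVec_apply]
  simp only [Function.comp_apply]
  rcases (e₂ (n := n)).symm j with k | k <;> rfl

/-- `archAct (ι^𝔻 p)` is `piArch ∘ Res_{𝔸_L/𝔸_{L⁺}}(p) ∘ archVec` (definitional). [cite: GelbartRogawski1991, §3.1 p. 454] -/
theorem archAct_toSpD_eq (p : HA L e dV hdV dW hdW) (a b : Fin (n + n) → mixedSpace (Fp L)) :
    archAct (gramDA L e dV hdV dW hdW) (toSpD L e dV hdV dW hdW p) (a, b) =
      (piArch (Fp L) (Fin (n + n))
          ((isQuadraticCoordinates_adele L (IsCMField.complexConj L) (complexConj_imagUnit L) (imagUnit_ne_zero L)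
              (imagUnit_mul_self L)).resEnd (Fin (n + n))
            (((p : GL (Fin (n + n)) (AdeleRing (𝓞 L) L)) : Matrix (Fin (n + n)) (Fin (n + n)) (AdeleRing (𝓞 L) L)))
            (archVec (Fp L) (Fin (n + n)) a, archVec (Fp L) (Fin (n + n)) b)).1,
        piArch (Fp L) (Fin (n + n))
          ((isQuadraticCoordinates_adele L (IsCMField.complexConj L) (complexConj_imagUnit L) (imagUnit_ne_zero L)
              (imagUnit_mul_self L)).resEnd (Fin (n + n))
            (((p : GL (Fin (n + n)) (AdeleRing (𝓞 L) L)) : Matrix (Fin (n + n)) (Fin (n + n)) (AdeleRing (𝓞 L) L)))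
            (archVec (Fp L) (Fin (n + n)) a, archVec (Fp L) (Fin (n + n)) b)).2) :=
  rfl

/-- **the `v`-slices of `archAct (ι^𝔻 p)` on a diagonal pair, `p ∈ P_Δ(𝔸)`**: they are the diagonal pair of
`Res_{ℂ/ℝ}(α_w) (a_v, z_v)`, `w ∣ v` any complex place over the real place `v` of `L⁺`, `α_w = σ_w((p₁₁ + p₁₂)_w)`.
[cite: Kudla1994, §3] [cite: GelbartRogawski1991, §3.1 p. 454] -/
theorem placeVec_archAct_toSpD_diagPair (p : HA L e dV hdV dW hdW) (hS : IsSiegelDelta L e dV hdV dW hdW p)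
    (v : {v : InfinitePlace (Fp L) // v.IsReal}) (w : {w : InfinitePlace L // w.IsComplex})
    (hover : w.1.comap (algebraMap (Fp L) L) = v.1) (a z : Fin n → mixedSpace (Fp L)) :
    (placeVec (Fp L) (Fin (n + n)) v
        (archAct (gramDA L e dV hdV dW hdW) (toSpD L e dV hdV dW hdW p)
          (Sum.elim a a ∘ ⇑(e₂ (n := n)).symm, Sum.elim z z ∘ ⇑(e₂ (n := n)).symm)).1,
      placeVec (Fp L) (Fin (n + n)) v
        (archAct (gramDA L e dV hdV dW hdW) (toSpD L e dV hdV dW hdW p)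
          (Sum.elim a a ∘ ⇑(e₂ (n := n)).symm, Sum.elim z z ∘ ⇑(e₂ (n := n)).symm)).2) =
      (Sum.elim (resDeltaBlockAt L e dV hdV dW hdW w p (placeVec (Fp L) (Fin n) v a, placeVec (Fp L) (Fin n) v z)).1
          (resDeltaBlockAt L e dV hdV dW hdW w p (placeVec (Fp L) (Fin n) v a, placeVec (Fp L) (Fin n) v z)).1 ∘
          ⇑(e₂ (n := n)).symm,
        Sum.elim (resDeltaBlockAt L e dV hdV dW hdW w p (placeVec (Fp L) (Fin n) v a, placeVec (Fp L) (Fin n) v z)).2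
          (resDeltaBlockAt L e dV hdV dW hdW w p (placeVec (Fp L) (Fin n) v a, placeVec (Fp L) (Fin n) v z)).2 ∘
          ⇑(e₂ (n := n)).symm) := by
  have key := placeVec_piArch_resEnd (Fp L) L (IsCMField.complexConj L) (Fin (n + n)) (complexConj_imagUnit L)
    (imagUnit_ne_zero L) (imagUnit_mul_self L) v w hover (re_embedding_imagUnit L w) (im_embedding_imagUnit_ne_zero L w)
    (((p : GL (Fin (n + n)) (AdeleRing (𝓞 L) L)) : Matrix (Fin (n + n)) (Fin (n + n)) (AdeleRing (𝓞 L) L)))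
    (Sum.elim a a ∘ ⇑(e₂ (n := n)).symm) (Sum.elim z z ∘ ⇑(e₂ (n := n)).symm)
  rw [archAct_toSpD_eq, key, placeVec_diag, placeVec_diag]
  unfold adeleMatAt
  rw [resEnd_diagPair _ (ccAt L w) _ (blocks_map_of_isSiegelDelta L e dV hdV dW hdW (adeleAt L w) p hS),
    blocks₁_map_eq_deltaBlock_map]
  rfl

end Slices

/-! ## §4 The global real-linear map `⊕_v Res_{ℂ/ℝ}(α_{w(v)})` on archimedean pairs -/

section DetComplex

variable {m : Type*} [Fintype m] [DecidableEq m]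

/-- `reIm` for the complex coordinates `ℂ = ℝ ⊕ ℝ δ'` is real-linear: `ℂᵐ ≃ₗ[ℝ] ℝᵐ × ℝᵐ`. [folklore] -/
private def reImL (δ' : ℂ) (hre : δ'.re = 0) (him : δ'.im ≠ 0) : (m → ℂ) ≃ₗ[ℝ] ((m → ℝ) × (m → ℝ)) :=
  (reIm (complexCoords δ' hre him) m).toLinearEquiv fun c x => by
    refine Prod.ext (funext fun i => ?_) (funext fun i => ?_)
    · rw [reIm_apply_fst, Pi.smul_apply, Prod.smul_fst, Pi.smul_apply, reIm_apply_fst, Complex.real_smul,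
        smul_eq_mul]
      exact (isQuadraticCoordinates_complex δ' hre him).re_map_mul c (x i)
    · rw [reIm_apply_snd, Pi.smul_apply, Prod.smul_snd, Pi.smul_apply, reIm_apply_snd, Complex.real_smul,
        smul_eq_mul]
      exact (isQuadraticCoordinates_complex δ' hre him).im_map_mul c (x i)

omit [Fintype m] [DecidableEq m] in
/-- `reImL = reIm` as functions. [folklore] -/
private theorem reImL_apply (δ' : ℂ) (hre : δ'.re = 0) (him : δ'.im ≠ 0) (x : m → ℂ) :
    reImL δ' hre him x = reIm (complexCoords δ' hre him) m x := rfl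

/-- `Res_{ℂ/ℝ} G = reIm ∘ G ∘ reIm⁻¹` as real-linear maps. [folklore] -/
private theorem resEnd_complex_eq_conj (δ' : ℂ) (hre : δ'.re = 0) (him : δ'.im ≠ 0) (G : Matrix m m ℂ) :
    ((isQuadraticCoordinates_complex δ' hre him).resEnd m G : ((m → ℝ) × (m → ℝ)) →ₗ[ℝ] ((m → ℝ) × (m → ℝ))) =
      (reImL (m := m) δ' hre him).toLinearMap ∘ₗ
        ((Matrix.toLin' G).restrictScalars ℝ) ∘ₗ (reImL (m := m) δ' hre him).symm.toLinearMap := by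
  apply LinearMap.ext
  intro q
  obtain ⟨x, rfl⟩ := (reImL (m := m) δ' hre him).surjective q
  rw [LinearMap.comp_apply, LinearMap.comp_apply, LinearEquiv.coe_toLinearMap, LinearEquiv.coe_toLinearMap,
    LinearEquiv.symm_apply_apply, reImL_apply, (isQuadraticCoordinates_complex δ' hre him).resEnd_reIm,
    LinearMap.restrictScalars_apply, Matrix.toLin'_apply, reImL_apply]

/-- **`det_ℝ (Res_{ℂ/ℝ} G) = |det_ℂ G|²`** for the restriction of scalars of `UnitaryGroupSymplecticEmbedding` in
complex coordinates (Mathlib `LinearMap.det_restrictScalars`, `Algebra.norm_complex_apply`): the archimedean case of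
`|x(m(a))| = |det a|` on the Siegel Levi. [cite: Kudla1994, §3] [cite: HarrisKudlaSweet1996, §1 (1.15)] -/
theorem det_resEnd_complex (δ' : ℂ) (hre : δ'.re = 0) (him : δ'.im ≠ 0) (G : Matrix m m ℂ) :
    LinearMap.det ((isQuadraticCoordinates_complex δ' hre him).resEnd m G) = Complex.normSq G.det := by
  rw [resEnd_complex_eq_conj, LinearMap.det_conj, LinearMap.det_restrictScalars, LinearMap.det_toLin',
    Algebra.norm_complex_apply]

end DetComplex

section Global

variable (L : Type) [Field L] [NumberField L] [IsCMField L]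
variable {N M n : ℕ} (e : Fin N × Fin M ≃ Fin n)
  (dV : Fin N → L) (hdV : ∀ i, IsCMField.complexConj L (dV i) = dV i)
  (dW : Fin M → L) (hdW : ∀ i, IsCMField.complexConj L (dW i) = dW i)

/-- a (complex) place of the CM field `L` over the real place `v` of `L⁺` (chosen; `comap` is onto).
[cite: BorelJacquet1979, §4.1] -/
def placeOver (v : {v : InfinitePlace (Fp L) // v.IsReal}) : {w : InfinitePlace L // w.IsComplex} :=
  ⟨(comap_surjective (K := L) (k := Fp L) v.1).choose, IsTotallyComplex.isComplex _⟩

/-- the chosen place lies over `v`. [cite: BorelJacquet1979, §4.1] -/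
theorem placeOver_comap (v : {v : InfinitePlace (Fp L) // v.IsReal}) :
    (placeOver L v).1.comap (algebraMap (Fp L) L) = v.1 :=
  (comap_surjective (K := L) (k := Fp L) v.1).choose_spec

variable (m : ℕ) in
/-- **real-place coordinates of archimedean pairs**: `(a, z) ↦ (v ↦ (a_v, z_v))`, a real-linear isomorphism
(`L⁺` is totally real, so an element of `L⁺ ⊗ ℝ` is its tuple of real-place coordinates). [cite: BorelJacquet1979, §4.1] -/
def pairPlaces : ((Fin m → mixedSpace (Fp L)) × (Fin m → mixedSpace (Fp L))) ≃ₗ[ℝ]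
    ({v : InfinitePlace (Fp L) // v.IsReal} → ((Fin m → ℝ) × (Fin m → ℝ))) where
  toFun az := fun v => (placeVec (Fp L) (Fin m) v az.1, placeVec (Fp L) (Fin m) v az.2)
  invFun q := (fun j => (fun v => (q v).1 j, fun _ => 0), fun j => (fun v => (q v).2 j, fun _ => 0))
  map_add' az az' := by
    funext v
    rfl
  map_smul' c az := by
    funext v
    rfl
  left_inv az := by
    haveI := isEmpty_isComplex (F := Fp L)
    refine Prod.ext (funext fun j => Prod.ext (funext fun v => rfl) (funext fun w => isEmptyElim w))
      (funext fun j => Prod.ext (funext fun v => rfl) (funext fun w => isEmptyElim w))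
  right_inv q := by
    funext v
    rfl

omit [IsCMField L] in
/-- components of `pairPlaces`. [cite: BorelJacquet1979, §4.1] -/
@[simp] theorem pairPlaces_apply {m : ℕ} (az : (Fin m → mixedSpace (Fp L)) × (Fin m → mixedSpace (Fp L)))
    (v : {v : InfinitePlace (Fp L) // v.IsReal}) :
    pairPlaces L m az v = (placeVec (Fp L) (Fin m) v az.1, placeVec (Fp L) (Fin m) v az.2) := rfl

omit [IsCMField L] in
/-- `(pairPlaces⁻¹ q)_v = q v`, first component. [cite: BorelJacquet1979, §4.1] -/
@[simp] theorem placeVec_pairPlaces_symm_fst {m : ℕ} (q : {v : InfinitePlace (Fp L) // v.IsReal} → ((Fin m → ℝ) × (Fin m → ℝ)))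
    (v : {v : InfinitePlace (Fp L) // v.IsReal}) :
    placeVec (Fp L) (Fin m) v ((pairPlaces L m).symm q).1 = (q v).1 := rfl

omit [IsCMField L] in
/-- `(pairPlaces⁻¹ q)_v = q v`, second component. [cite: BorelJacquet1979, §4.1] -/
@[simp] theorem placeVec_pairPlaces_symm_snd {m : ℕ} (q : {v : InfinitePlace (Fp L) // v.IsReal} → ((Fin m → ℝ) × (Fin m → ℝ)))
    (v : {v : InfinitePlace (Fp L) // v.IsReal}) :
    placeVec (Fp L) (Fin m) v ((pairPlaces L m).symm q).2 = (q v).2 := rfl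

/-- **`A_p = ⊕_v Res_{ℂ/ℝ}(α_{w(v)})`** — the real-linear map of archimedean pairs `(a, z) ∈ (L⁺ ⊗ ℝ)ⁿ × (L⁺ ⊗ ℝ)ⁿ`
through which `ι^𝔻(p)`, `p ∈ P_Δ(𝔸)`, acts on diagonal pairs: `Res(α_p)` read in real-place coordinates
(`α_p = p₁₁ + p₁₂ = deltaBlock p`, `w(v) = placeOver v`). [cite: Kudla1994, §3] -/
def archDiagAct (p : HA L e dV hdV dW hdW) :
    ((Fin n → mixedSpace (Fp L)) × (Fin n → mixedSpace (Fp L))) →ₗ[ℝ]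
      ((Fin n → mixedSpace (Fp L)) × (Fin n → mixedSpace (Fp L))) :=
  ((pairPlaces L n).symm : _ →ₗ[ℝ] ((Fin n → mixedSpace (Fp L)) × (Fin n → mixedSpace (Fp L)))) ∘ₗ
    (LinearMap.pi fun v : {v : InfinitePlace (Fp L) // v.IsReal} =>
        resDeltaBlockAt L e dV hdV dW hdW (placeOver L v) p ∘ₗ LinearMap.proj v) ∘ₗ
      ((pairPlaces L n : _ ≃ₗ[ℝ] _) : ((Fin n → mixedSpace (Fp L)) × (Fin n → mixedSpace (Fp L))) →ₗ[ℝ] _)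

/-- the `v`-coordinates of `A_p (a, z)` are `Res_{ℂ/ℝ}(α_{w(v)}) (a_v, z_v)`. [cite: Kudla1994, §3] -/
theorem pairPlaces_archDiagAct (p : HA L e dV hdV dW hdW)
    (az : (Fin n → mixedSpace (Fp L)) × (Fin n → mixedSpace (Fp L))) (v : {v : InfinitePlace (Fp L) // v.IsReal}) :
    pairPlaces L n (archDiagAct L e dV hdV dW hdW p az) v =
      resDeltaBlockAt L e dV hdV dW hdW (placeOver L v) p (pairPlaces L n az v) := by
  unfold archDiagAct
  rw [LinearMap.comp_apply, LinearMap.comp_apply, LinearEquiv.coe_coe, LinearEquiv.coe_coe,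
    LinearEquiv.apply_symm_apply]
  rfl

/-- **`ι^𝔻(p)` acts on diagonal archimedean pairs through `A_p`**: for `p ∈ P_Δ(𝔸)` and archimedean
`a, z ∈ (L⁺ ⊗ ℝ)ⁿ`, `archAct (ι^𝔻 p) ((a,a),(z,z)) = (((A_p(a,z))₁, (A_p(a,z))₁), ((A_p(a,z))₂, (A_p(a,z))₂))`.
[cite: Kudla1994, §3] [cite: GelbartRogawski1991, §3.1 p. 454] -/
theorem archAct_toSpD_diagPair (p : HA L e dV hdV dW hdW) (hS : IsSiegelDelta L e dV hdV dW hdW p)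
    (az : (Fin n → mixedSpace (Fp L)) × (Fin n → mixedSpace (Fp L))) :
    archAct (gramDA L e dV hdV dW hdW) (toSpD L e dV hdV dW hdW p)
        (Sum.elim az.1 az.1 ∘ ⇑(e₂ (n := n)).symm, Sum.elim az.2 az.2 ∘ ⇑(e₂ (n := n)).symm) =
      (Sum.elim (archDiagAct L e dV hdV dW hdW p az).1 (archDiagAct L e dV hdV dW hdW p az).1 ∘ ⇑(e₂ (n := n)).symm,
        Sum.elim (archDiagAct L e dV hdV dW hdW p az).2 (archDiagAct L e dV hdV dW hdW p az).2 ∘ ⇑(e₂ (n := n)).symm) := by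
  apply (pairPlaces L (n + n)).injective
  funext v
  rw [pairPlaces_apply, pairPlaces_apply, placeVec_archAct_toSpD_diagPair L e dV hdV dW hdW p hS v (placeOver L v)
    (placeOver_comap L v) az.1 az.2, placeVec_diag, placeVec_diag]
  have h := pairPlaces_archDiagAct L e dV hdV dW hdW p az v
  rw [pairPlaces_apply, pairPlaces_apply] at h
  rw [← h]

/-- `det_ℝ (Res_{ℂ/ℝ} α_w) = |det α_w|²`. [cite: Kudla1994, §3] -/
theorem det_resDeltaBlockAt (w : {w : InfinitePlace L // w.IsComplex}) (p : HA L e dV hdV dW hdW) :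
    LinearMap.det (resDeltaBlockAt L e dV hdV dW hdW w p) =
      Complex.normSq (adeleMatAt L (Fin n) w (deltaBlock L e dV hdV dW hdW p)).det :=
  det_resEnd_complex _ _ _ _

/-- **`det_ℝ A_p = ∏_v |det α_{w(v)}|²`** (`LinearMap.det_pi` after conjugating away the coordinates).
[cite: Kudla1994, §3] [cite: HarrisKudlaSweet1996, §1 (1.15)] -/
theorem det_archDiagAct (p : HA L e dV hdV dW hdW) :
    LinearMap.det (archDiagAct L e dV hdV dW hdW p) =
      ∏ v : {v : InfinitePlace (Fp L) // v.IsReal},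
        Complex.normSq (adeleMatAt L (Fin n) (placeOver L v) (deltaBlock L e dV hdV dW hdW p)).det := by
  have h : archDiagAct L e dV hdV dW hdW p =
      ((pairPlaces L n).symm : _ →ₗ[ℝ] ((Fin n → mixedSpace (Fp L)) × (Fin n → mixedSpace (Fp L)))) ∘ₗ
        (LinearMap.pi fun v : {v : InfinitePlace (Fp L) // v.IsReal} =>
            resDeltaBlockAt L e dV hdV dW hdW (placeOver L v) p ∘ₗ LinearMap.proj v) ∘ₗ
          (((pairPlaces L n).symm.symm : _ ≃ₗ[ℝ] _) :
            ((Fin n → mixedSpace (Fp L)) × (Fin n → mixedSpace (Fp L))) →ₗ[ℝ] _) := rfl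
  rw [h, LinearMap.det_conj, LinearMap.det_pi]
  exact Finset.prod_congr rfl fun v _ => det_resDeltaBlockAt L e dV hdV dW hdW (placeOver L v) p

end Global

end Literature.NumberTheory.GelbartRogawski1991.GRConstruction

end
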